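import Literature.NumberTheory.EllipticCurves.KuriharaNumber
import HarnessLib

/-!
# Kurihara numbers under reduction of the modulus `ℤ/p^k → ℤ/p^j`: `δ̃^{(k)}_n ↦ δ̃^{(j)}_n`
# (cell `b2b-bsdres`, team n1011, ROUTE-1 §35.6 / R1-61 record side; seat p18; TOOL lemmas)

HONEST FRAMING (cell `b2b-bsdres`, run/shared/lean/b2b/bsd-rank1-residual/, verbatim in every
file): the goal of the cell is to DELETE the COMBINATION-SHAPED residual classes of the
Birch–Swinnerton-Dyer formula for ALL analytic-rank `≤ 1` elliptic curves over `ℚ` — "full BSD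
formula for every rank `≤ 1` curve in class `C`" assembled STRICTLY from published theorems — so
that the rank-`≤ 1` remainder becomes exactly the CONSTRUCTION-SHAPED classes, which are TYPED
(missing-input `Prop`s), NOT attempted. This is not "finishing BSD". Team n1011 (N10/N11, the
additive block `X4 ∧ p = 3`): research route; TOOL lemmas only (no definition, no named fact);
nothing booked; no mark / label moved.

## What and why

Route planner 1 (ROUTE-1 §35.6): "the depth-2 certificate an INJ-DEV END will consume is an ORDINARY
mod-3 Kurihara number `δ̃_n ≢ 0 (mod 3)` (`δ̃^{(9)} mod 3 = δ̃^{(3)}`)".  n1011-p15's END-m2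
(`KolyvaginLevelTwoNineDivides`, F-D) states its certificate as `3 · δ̃^{(9)}_n(ψ₉) ≠ 0` in `ℤ/9`
for discrete logarithms `ψ₉` onto `ℤ/9`, and the END-m2 record corollaries
(`KuriharaRecordBSDpThreeLevelTwoEnd*`, this seat) inherit that currency, whereas the END-m1 records
and the engines speak `δ̃^{(3)}_n(ψ₃) ≢ 0 (mod 3)` for `ψ₃` onto `ℤ/3`.  This file proves the
elementary bridge, for any prime `p`, cusp form `f` and `j ≤ k`:

* `castHom_ratModP_pow` — `\overline{q}^{(p^k)} ↦ \overline{q}^{(p^j)}` under `ℤ/p^k → ℤ/p^j` for a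
  `p`-integral rational `q` (both are the images of `q ∈ ℤ_(p)`; `ratModP_eq_toZModPow`);
* `castHom_kuriharaNumber_pow` — `δ̃^{(k)}_n(ψ) ↦ δ̃^{(j)}_n(ψ mod p^j)` when the symbols `[a/n]⁺_f`
  are `p`-integral (e.g. `E[p]` irreducible, `gcd(n, N) = 1`:
  `IsNewformOf.not_dvd_den_ratPlusSymbol_div`), where `ψ mod p^j` is the composite of `ψ_ℓ` with
  `ℤ/p^k → ℤ/p^j` — again a surjective discrete logarithm;
* `surjective_castHom_comp` — surjectivity is preserved;
* `three_mul_eq_zero_iff_castHom_eq_zero` — in `ℤ/9`: `3·x = 0 ↔ x ≡ 0 (mod 3)`.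

Consumer: `GaloisImage/KuriharaRecordBSDpThreeLevelTwoEndModThree.lean` (END-m2 records in the
END-m1 / engine currency `δ̃_n ≢ 0 (mod 3)`).

References: C.-H. Kim, AJM 148 (2026) §1.4.3 [Kim2022StructureSelmer]; M. Kurihara, Münster J. Math.
7 (2014) §1.1 [Kurihara2014].
-/

noncomputable section

open scoped Classical MatrixGroups ModularForm
open CongruenceSubgroup Literature.NumberTheory.EllipticCurves Literature.NumberTheory.EllipticCurves.ModularForms
open Literature.NumberTheory.DiophantineGeometry.Dioph (ratModP)

namespace Summit.BirchSwinnertonDyer.Rank1Residual.Additive.KuriharaReduction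

/-- **Reduction of the modulus commutes with `ratModP` on `p`-integral rationals**: for `p ∤ den q`
and `j ≤ k`, the image of `\overline{q} ∈ ℤ/p^k` in `ℤ/p^j` is `\overline{q} ∈ ℤ/p^j` — both are the
reductions of the `p`-adic integer `q` (`ratModP_eq_toZModPow`, `PadicInt.zmod_cast_comp_toZModPow`).
(False without `p`-integrality: the junk inverses of `ZMod` do not commute with the cast.)
[folklore] -/
theorem castHom_ratModP_pow (p : ℕ) [Fact p.Prime] {j k : ℕ} (hjk : j ≤ k) {q : ℚ}
    (hq : ¬ p ∣ q.den) :
    ZMod.castHom (pow_dvd_pow p hjk) (ZMod (p ^ j)) (ratModP (p ^ k) q) = ratModP (p ^ j) q := by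
  rw [ratModP_eq_toZModPow p k hq, ratModP_eq_toZModPow p j hq]
  exact RingHom.congr_fun (PadicInt.zmod_cast_comp_toZModPow j k hjk) _

/-- **Reduction of the modulus on Kurihara numbers**: for `j ≤ k` and discrete logarithms `ψ_ℓ`
into `ℤ/p^k`, if every symbol `[a/n]⁺_f` (`a ∈ (ℤ/n)ˣ`) is `p`-integral then the image of
`δ̃^{(k)}_n(ψ) ∈ ℤ/p^k` in `ℤ/p^j` is `δ̃^{(j)}_n(ψ mod p^j)`, the Kurihara number for the composite
logarithms `(ℤ/ℓ)ˣ → ℤ/p^k → ℤ/p^j` — Kim's "`δ̃^{(k)}_n mod p^j = δ̃^{(j)}_n`" (AJM 148 §1.4.3: the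
`δ̃^{(k)}_n` are compatible under the reduction maps). [cite: Kim2022StructureSelmer, §1.4.3 (PDF p. 7)] -/
theorem castHom_kuriharaNumber_pow {N : ℕ} (f : CuspForm (Gamma0 N) 2) (p : ℕ) [Fact p.Prime]
    {j k : ℕ} (hjk : j ≤ k) (n : ℕ) [NeZero n]
    (ψ : (ℓ : ℕ) → (ZMod ℓ)ˣ →* Multiplicative (ZMod (p ^ k)))
    (hden : ∀ a : (ZMod n)ˣ, ¬ p ∣ (ratPlusSymbol f (((a : ZMod n).val : ℚ) / n)).den) :
    ZMod.castHom (pow_dvd_pow p hjk) (ZMod (p ^ j)) (kuriharaNumber f (p ^ k) n ψ) =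
      kuriharaNumber f (p ^ j) n
        (fun ℓ => (ZMod.castHom (pow_dvd_pow p hjk) (ZMod (p ^ j))).toAddMonoidHom.toMultiplicative.comp
          (ψ ℓ)) := by
  rw [kuriharaNumber_def, kuriharaNumber_def, map_sum]
  refine Finset.sum_congr rfl fun a _ => ?_
  rw [map_mul, castHom_ratModP_pow p hjk (hden a), map_prod]
  rfl

/-- The composite of a surjective discrete logarithm `(ℤ/ℓ)ˣ → ℤ/p^k` with the (surjective) reduction
`ℤ/p^k → ℤ/p^j` is surjective. [folklore] -/
theorem surjective_castHom_comp (p : ℕ) {j k : ℕ} (hjk : j ≤ k) {ℓ : ℕ}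
    {ψ : (ZMod ℓ)ˣ →* Multiplicative (ZMod (p ^ k))} (hψ : Function.Surjective ψ) :
    Function.Surjective
      ((ZMod.castHom (pow_dvd_pow p hjk) (ZMod (p ^ j))).toAddMonoidHom.toMultiplicative.comp ψ) := by
  intro y
  obtain ⟨x, hx⟩ := ZMod.castHom_surjective (pow_dvd_pow p hjk) (Multiplicative.toAdd y)
  obtain ⟨u, hu⟩ := hψ (Multiplicative.ofAdd x)
  refine ⟨u, ?_⟩
  simp only [MonoidHom.coe_comp, Function.comp_apply, hu, AddMonoidHom.coe_toMultiplicative,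
    toAdd_ofAdd, RingHom.toAddMonoidHom_eq_coe, AddMonoidHom.coe_coe, hx, ofAdd_toAdd]

/-- In `ℤ/9`: `3 · x = 0` iff `x ≡ 0 (mod 3)` — the END-m2 certificate currency
`3 · δ̃^{(9)} ≠ 0` is `δ̃^{(9)} mod 3 ≠ 0`. [folklore] -/
theorem three_mul_eq_zero_iff_castHom_eq_zero (x : ZMod (3 ^ 2)) :
    (3 : ZMod (3 ^ 2)) * x = 0 ↔
      ZMod.castHom (pow_dvd_pow 3 (Nat.le_succ 1)) (ZMod (3 ^ 1)) x = 0 := by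
  revert x
  decide

end Summit.BirchSwinnertonDyer.Rank1Residual.Additive.KuriharaReduction

end
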